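import Literature.AnabelianGeometry.EtaleTheta.Discharge.Sec3Cor38iiiHoldsWeak
import Literature.AlgebraicGeometry.Frobenioids.EquivalencePreStepsFSMFF2008Assembly
import HarnessLib

/-!
# [EtTh] Corollary 3.8 (iii), first clause, over the WEAK monoid vocabulary — rows C38-L01 and C38-L02a
# DISCHARGED from the Cor. 3.8 data alone: `Cor38_iii h` modulo `IsFrobenioid` and the Def. 3.1 support axioms

Mochizuki, *The étale theta function …*, Publ. RIMS **45** (2009), Thm. 3.7 (i)(ii) p.79, Cor. 3.8 (iii) p.81, proof
p.82 [cite: MochizukiEtTh2009, Cor 3.8 p.81]: "by Theorem 3.7, (i), (ii), `C₁`, `C₂` are of standard and isotropic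
type, but not of group-like type. In particular, by [Mzk17], Theorem 3.4, (ii); [Mzk17], Theorem 4.2, (i), it follows
that `Ψ` preserves pre-steps and primary steps."  [Mzk17] = Mochizuki, *The geometry of Frobenioids I*, Kyushu J.
Math. **62** (2008), Thm. 3.4 (ii) p.62 [cite: MochizukiFrdI2008, Thm. 3.4 (ii) p.62].

abc-iut cell, layer L2, node `EtTh:Cor3.8(iii)`, seat abc-iut-L2-d2 (gen 4); proof-only sequel of
`Sec3Cor38iiiHoldsWeak.lean` (`Cor38Hyp.cor38_iii_of_preservesPreSteps_weak`: the clause modulo `hF_i`, C38-L01,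
C38-L02a and the support axioms), removing its two ROW binders for every pair of tempered Frobenioids whose realified
base data are typed over abc-iut-L2-t3's `treeMonoidVocabWeak` (findings F-L2d2-1 / F-L2d2-2) — at ANY category
vocabulary `VD`:

* C38-L01 (Thm. 3.7 (i)(ii): standard, isotropic, not group-like) holds with NO residual from the fields `h.fsmff`
  ("`D_i` of FSMFF-type") and `h.nonDilating` ("`Φ_i` non-dilating") of the Cor. 3.8 data — the weak-vocabulary twin of
  abc-iut-w5-d135 lineage's `standardIsotropicNotGroupLike_treeMonoidVocab` (`Sec3Cor38StdIsoNotGLUnconditional.lean`):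
  the divisor monoids are sharp because WEAKLY perf-factorial ⟹ divisorial (Def. 3.6 (ii) read at the weak vocabulary),
  whence abc-iut-w4-d103's `opsData_isOfStandardType_of_isSharp`; isotropic / not group-like are vocabulary-free
  (`opsData_isOfIsotropicType`, `opsData_not_isOfGroupLikeType`):
  `TemperedFrobenioid.isSharp_carrier_treeMonoidVocabWeak`, `opsData_isOfStandardType_treeMonoidVocabWeak`,
  `Cor38Hyp.standardIsotropicNotGroupLike_treeMonoidVocabWeak`, `thm42Setting_symm_treeMonoidVocabWeak`;
* C38-L02a ("`Ψ`, `Ψ⁻¹` preserve pre-steps") holds modulo `hF₁`, `hF₂` from the tree's PROVED [FrdI] Thm. 3.4 (ii)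
  AS PRINTED (`FrdI.thm34ii_ofFunctor`, seat abc-iut-L1-t13 lineage, over the 2008 FSMFF bases `h.fsmff`; quasi-isotropic
  type from Thm. 3.7 (i), `data_isOfQuasiIsotropicType_weak`): `Cor38Hyp.preservesPreSteps_of_isFrobenioid_weak`;
* hence **`Cor38Hyp.cor38_iii_of_isFrobenioid_weak`: abc-iut-L2-t3's typed `Cor38_iii h` HOLDS for every `h : Cor38Hyp
  C₁ C₂` over the weak vocabulary modulo ONLY `hF₁`, `hF₂` ([FrdI] Thm. 5.2 (ii): "`C_i → F_{Φ_i}` is a Frobenioid")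
  and abc-iut-L2-d2's Def. 3.1 support axioms `hD1`/`hDa`/`hDn`/`hDc` on both sides** — primary pre-steps by [FrdI]
  Thm. 4.2 (i) for weakly perf-factorial `Φ_i` (abc-iut-L1-t12's `Thm42PrimaryStepsGeneralWeak`), Frobenius type by
  Thm. 3.4 (iii) (`FrdI.isFrobeniusCompatible_of_preservesPreSteps`); also `preservesPrimarySteps_of_isFrobenioid_weak`
  (row C38-L02b) and, at the canonical category vocabulary, `cor38_iii_treeCatVocab_of_isMonoidOn_weak` (modulo
  `hBmon_i : IsMonoidOn B_i` and the support axioms only).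

No definitions; no statement of either paper is restated or strengthened.  HONEST FRAMING: refereed pre-IUT material;
nothing here bears on [IUTchIII] Cor. 3.12; typed ≠ proved — here PROVED modulo the named inputs.
-/

namespace Literature.AnabelianGeometry.EtaleTheta

open CategoryTheory Opposite Literature.AlgebraicGeometry.Frobenioids

universe u₀ v₀ u v w

/-! ### Thm. 3.7 (ii), first clause, at the weak monoid vocabulary with NO residual -/

namespace TemperedFrobenioid

variable {D₀ : Type u₀} [Category.{v₀} D₀] {T : RealifiedDivisorMonoids (D₀ := D₀) treeMonoidVocabWeak.{w}}
  {D : Type u} [Category.{v} D] {VD : FrdICatStub.{u, v, w} D}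

/-- At the WEAK monoid vocabulary the divisor monoids `Φ(A)` are sharp: Def. 3.6 (ii) "perf-factorial" read as
`IsPerfFactorialCof` ⟹ weakly perf-factorial ⟹ divisorial ([FrdI] Def. 2.4 (i)(a)) ⟹ sharp.
[cite: MochizukiEtTh2009, Def 3.6 p.77] -/
theorem isSharp_carrier_treeMonoidVocabWeak (C : TemperedFrobenioid T D VD) (A : Dᵒᵖ) : IsSharp (C.Φ.carrier A) :=
  (C.objectwise_isDivisorial_weak (unop A)).isSharp

/-- **Thm. 3.7 (ii), first clause, at the WEAK monoid vocabulary with NO residual** (any category vocabulary): `D` of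
FSMFF-type and `Φ` non-dilating ⟹ `C` of standard type (abc-iut-w4-d103's `opsData_isOfStandardType_of_isSharp`).
[cite: MochizukiEtTh2009, Thm 3.7 (ii) p.79] -/
theorem opsData_isOfStandardType_treeMonoidVocabWeak (C : TemperedFrobenioid T D VD) (hD : IsOfFSMFFType D)
    (hnd : IsNonDilatingOn C.divisorMonoid) : C.opsData.IsOfStandardType :=
  C.opsData_isOfStandardType_of_isSharp C.isSharp_carrier_treeMonoidVocabWeak hD hnd

/-- **Thm. 3.7 (ii), first clause, at the WEAK monoid vocabulary, non-dilating hypothesis in the shape of the Cor. 3.8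
data** (`∀ (A : Dᵒᵖ) (f : A ⟶ A), V.IsNonDilating (Φ(A)) (Φ.pull f)`, which at `treeMonoidVocabWeak` IS the tree's
`IsNonDilatingOn Φ`, `isNonDilatingOn_iff_pull_weak`) — any category vocabulary, no residual.
[cite: MochizukiEtTh2009, Thm 3.7 (ii) p.79] -/
theorem opsData_isOfStandardType_treeMonoidVocabWeak_of_forall_pull (C : TemperedFrobenioid T D VD)
    (hD : IsOfFSMFFType D)
    (hnd : ∀ (A : Dᵒᵖ) (f : A ⟶ A), treeMonoidVocabWeak.{w}.IsNonDilating (C.Φ.carrier A) (C.Φ.pull f)) :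
    C.opsData.IsOfStandardType :=
  C.opsData_isOfStandardType_treeMonoidVocabWeak hD ((C.isNonDilatingOn_iff_pull_weak).2 hnd)

/-- … and the equivalence form at `treeMonoidVocabWeak` (Thm. 3.7 (ii)'s hypotheses are also necessary,
`opsData_isOfStandardType_iff_of_isSharp`). [cite: MochizukiEtTh2009, Thm 3.7 (ii) p.79] -/
theorem opsData_isOfStandardType_treeMonoidVocabWeak_iff (C : TemperedFrobenioid T D VD) :
    C.opsData.IsOfStandardType ↔ IsOfFSMFFType D ∧ IsNonDilatingOn C.divisorMonoid :=
  C.opsData_isOfStandardType_iff_of_isSharp C.isSharp_carrier_treeMonoidVocabWeak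

end TemperedFrobenioid

/-! ### Rows C38-L01 and C38-L02a over the weak monoid vocabulary, any category vocabulary -/

namespace Cor38Hyp

section TreeMonoidVocabWeak

variable {D₀ : Type u₀} [Category.{v₀} D₀] {D₀' : Type u₀} [Category.{v₀} D₀']
  {T : RealifiedDivisorMonoids (D₀ := D₀) treeMonoidVocabWeak.{w}}
  {T' : RealifiedDivisorMonoids (D₀ := D₀') treeMonoidVocabWeak.{w}}
  {D : Type u} [Category.{v} D] {D' : Type u} [Category.{v} D']
  {VD : FrdICatStub.{u, v, w} D} {VD' : FrdICatStub.{u, v, w} D'}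

open TemperedFrobenioid

/-- **C38-L01 — "by Theorem 3.7, (i), (ii), `C₁`, `C₂` are of standard and isotropic type, but not of group-like type" —
PROVED with NO residual** for every pair of tempered Frobenioids over the WEAK monoid vocabulary (arbitrary category
vocabularies): `StandardIsotropicNotGroupLike h` from the fields `h.fsmff`, `h.nonDilating` of the Cor. 3.8 data.
[cite: MochizukiEtTh2009, Cor 3.8 p.81] -/
theorem standardIsotropicNotGroupLike_treeMonoidVocabWeak {C₁ : TemperedFrobenioid T D VD}
    {C₂ : TemperedFrobenioid T' D' VD'} (h : Cor38Hyp C₁ C₂) : h.StandardIsotropicNotGroupLike :=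
  ⟨⟨C₁.opsData_isOfStandardType_treeMonoidVocabWeak_of_forall_pull h.fsmff.1 h.nonDilating.1,
      C₂.opsData_isOfStandardType_treeMonoidVocabWeak_of_forall_pull h.fsmff.2 h.nonDilating.2⟩,
    ⟨C₁.opsData_isOfIsotropicType, C₂.opsData_isOfIsotropicType⟩,
    ⟨C₁.opsData_not_isOfGroupLikeType, C₂.opsData_not_isOfGroupLikeType⟩⟩

/-- The symmetric setting (for the `Ψ⁻¹`-directions), with no residual. [cite: MochizukiEtTh2009, Cor 3.8 p.81] -/
theorem thm42Setting_symm_treeMonoidVocabWeak {C₁ : TemperedFrobenioid T D VD}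
    {C₂ : TemperedFrobenioid T' D' VD'} (h : Cor38Hyp C₁ C₂) :
    PreFrobenioidData.Thm42Setting C₂.opsData C₁.opsData :=
  h.standardIsotropicNotGroupLike_symm h.standardIsotropicNotGroupLike_treeMonoidVocabWeak

/-- **The universal closure of row C38-L01 over the WEAK monoid vocabulary HOLDS** (all base data, all category
vocabularies, all Cor. 3.8 data). [cite: MochizukiEtTh2009, Cor 3.8 p.81] -/
theorem forall_standardIsotropicNotGroupLike_treeMonoidVocabWeak :
    ∀ (D₀ : Type u₀) (_ : Category.{v₀} D₀) (D₀' : Type u₀) (_ : Category.{v₀} D₀')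
      (T : RealifiedDivisorMonoids (D₀ := D₀) treeMonoidVocabWeak.{w})
      (T' : RealifiedDivisorMonoids (D₀ := D₀') treeMonoidVocabWeak.{w})
      (D : Type u) (_ : Category.{v} D) (D' : Type u) (_ : Category.{v} D')
      (VD : FrdICatStub.{u, v, w} D) (VD' : FrdICatStub.{u, v, w} D')
      (C₁ : TemperedFrobenioid T D VD) (C₂ : TemperedFrobenioid T' D' VD') (h : Cor38Hyp C₁ C₂),
      h.StandardIsotropicNotGroupLike :=
  fun _ _ _ _ _ _ _ _ _ _ _ _ _ _ h => h.standardIsotropicNotGroupLike_treeMonoidVocabWeak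

/-- **C38-L02a — "`Ψ`, `Ψ⁻¹` preserve pre-steps" — from the Cor. 3.8 data modulo `hF₁`, `hF₂`** over the weak monoid
vocabulary (any category vocabulary): the tree's PROVED [FrdI] Thm. 3.4 (ii) AS PRINTED (`FrdI.thm34ii_ofFunctor`, over
bases of FSMFF-type in the 2008 sense = `h.fsmff`) for the Frobenioids `C₁`, `C₂`, of quasi-isotropic type because of
isotropic type (Thm. 3.7 (i); [FrdI] Rem. 3.1.1, `data_isOfQuasiIsotropicType_weak`). [cite: MochizukiEtTh2009, Cor 3.8 p.81] -/
theorem preservesPreSteps_of_isFrobenioid_weak {C₁ : TemperedFrobenioid T D VD} {C₂ : TemperedFrobenioid T' D' VD'}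
    (h : Cor38Hyp C₁ C₂) (hF₁ : PreFrobenioid.IsFrobenioid C₁.toElem) (hF₂ : PreFrobenioid.IsFrobenioid C₂.toElem) :
    h.PreservesPreSteps :=
  h.preservesPreSteps_of_thm34ii (FrdI.thm34ii_ofFunctor hF₁ hF₂ h.Ψ) (FrdI.thm34ii_ofFunctor hF₂ hF₁ h.Ψ.symm)
    (C₁.data_isOfQuasiIsotropicType_weak hF₁) (C₂.data_isOfQuasiIsotropicType_weak hF₂)

/-- **C38-L02b — "`Ψ`, `Ψ⁻¹` preserve primary steps" — from the Cor. 3.8 data modulo `hF₁`, `hF₂`** over the weak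
monoid vocabulary (C38-L01 and C38-L02a discharged; [FrdI] Thm. 4.2 (i) for weakly perf-factorial `Φ_i`).
[cite: MochizukiEtTh2009, Cor 3.8 p.81] -/
theorem preservesPrimarySteps_of_isFrobenioid_weak {C₁ : TemperedFrobenioid T D VD}
    {C₂ : TemperedFrobenioid T' D' VD'} (h : Cor38Hyp C₁ C₂) (hF₁ : PreFrobenioid.IsFrobenioid C₁.toElem)
    (hF₂ : PreFrobenioid.IsFrobenioid C₂.toElem) : h.PreservesPrimarySteps :=
  h.preservesPrimarySteps_of_preservesPreSteps_weak hF₁ hF₂ h.standardIsotropicNotGroupLike_treeMonoidVocabWeak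
    (h.preservesPreSteps_of_isFrobenioid_weak hF₁ hF₂)

/-- **`Ψ` carries primary pre-steps to primary pre-steps, from the Cor. 3.8 data modulo `hF₁`, `hF₂`** (weak monoid
vocabulary, any category vocabulary) — the binder `hprim` of `cor38_iii_of_weak` / `cor38_iii_ofRlfZWeak…` with NO row
input left. [cite: MochizukiEtTh2009, Cor 3.8 p.82] -/
theorem isPrimaryPreStep_map_of_isFrobenioid_weak {C₁ : TemperedFrobenioid T D VD}
    {C₂ : TemperedFrobenioid T' D' VD'} (h : Cor38Hyp C₁ C₂) (hF₁ : PreFrobenioid.IsFrobenioid C₁.toElem)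
    (hF₂ : PreFrobenioid.IsFrobenioid C₂.toElem) ⦃X Y : C₁.category⦄ (φ : X ⟶ Y)
    (hφ : PreFrobenioid.IsPrimaryPreStep C₁.toElem φ) : PreFrobenioid.IsPrimaryPreStep C₂.toElem (h.Ψ.functor.map φ) :=
  h.isPrimaryPreStep_map_of_preservesPreSteps_weak hF₁ hF₂ h.standardIsotropicNotGroupLike_treeMonoidVocabWeak
    (h.preservesPreSteps_of_isFrobenioid_weak hF₁ hF₂) φ hφ

/-- … and `Ψ⁻¹` (the binder `hprim'`). [cite: MochizukiEtTh2009, Cor 3.8 p.82] -/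
theorem isPrimaryPreStep_inverse_map_of_isFrobenioid_weak {C₁ : TemperedFrobenioid T D VD}
    {C₂ : TemperedFrobenioid T' D' VD'} (h : Cor38Hyp C₁ C₂) (hF₁ : PreFrobenioid.IsFrobenioid C₁.toElem)
    (hF₂ : PreFrobenioid.IsFrobenioid C₂.toElem) ⦃X Y : C₂.category⦄ (φ : X ⟶ Y)
    (hφ : PreFrobenioid.IsPrimaryPreStep C₂.toElem φ) : PreFrobenioid.IsPrimaryPreStep C₁.toElem (h.Ψ.inverse.map φ) :=
  h.isPrimaryPreStep_inverse_map_of_preservesPreSteps_weak hF₁ hF₂ h.standardIsotropicNotGroupLike_treeMonoidVocabWeak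
    (h.preservesPreSteps_of_isFrobenioid_weak hF₁ hF₂) φ hφ

/-- **[EtTh] Cor. 3.8 (iii), first clause, AS TYPED (abc-iut-L2-t3's `Cor38_iii`) HOLDS over the WEAK monoid vocabulary
(any category vocabulary) modulo ONLY `hF₁`, `hF₂` ([FrdI] Thm. 5.2 (ii)) and abc-iut-L2-d2's Def. 3.1 support axioms on
both sides** — rows C38-L01 (Thm. 3.7 (i)(ii)) and C38-L02a ([FrdI] Thm. 3.4 (ii)) DISCHARGED from the Cor. 3.8 data,
primary pre-steps by [FrdI] Thm. 4.2 (i) for weakly perf-factorial `Φ_i`, Frobenius type by Thm. 3.4 (iii).  PROVED.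
[cite: MochizukiEtTh2009, Cor 3.8 p.81] -/
theorem cor38_iii_of_isFrobenioid_weak {C₁ : TemperedFrobenioid T D VD} {C₂ : TemperedFrobenioid T' D' VD'}
    (h : Cor38Hyp C₁ C₂) (hF₁ : PreFrobenioid.IsFrobenioid C₁.toElem) (hF₂ : PreFrobenioid.IsFrobenioid C₂.toElem)
    (hD1₁ : ∀ (A : Dᵒᵖ) (y : C₁.Φ.carrier A), C₁.IsBaseFieldTheoreticDiv y → C₁.IsNonCuspidal y)
    (hDa₁ : ∀ (A : Dᵒᵖ) (x : C₁.Φ.carrier A), C₁.IsNonCuspidal x → C₁.IsCuspidal x → x = 1)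
    (hDn₁ : ∀ (A : Dᵒᵖ) (x : C₁.Φ.carrier A),
      C₁.IsNonCuspidal x ↔ ∀ y : C₁.Φ.carrier A, IsPrimary y → Precsim y x → C₁.IsNonCuspidal y)
    (hDc₁ : ∀ (A : Dᵒᵖ) (x : C₁.Φ.carrier A),
      C₁.IsCuspidal x ↔ ∀ y : C₁.Φ.carrier A, IsPrimary y → Precsim y x → C₁.IsCuspidal y)
    (hD1₂ : ∀ (A : D'ᵒᵖ) (y : C₂.Φ.carrier A), C₂.IsBaseFieldTheoreticDiv y → C₂.IsNonCuspidal y)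
    (hDa₂ : ∀ (A : D'ᵒᵖ) (x : C₂.Φ.carrier A), C₂.IsNonCuspidal x → C₂.IsCuspidal x → x = 1)
    (hDn₂ : ∀ (A : D'ᵒᵖ) (x : C₂.Φ.carrier A),
      C₂.IsNonCuspidal x ↔ ∀ y : C₂.Φ.carrier A, IsPrimary y → Precsim y x → C₂.IsNonCuspidal y)
    (hDc₂ : ∀ (A : D'ᵒᵖ) (x : C₂.Φ.carrier A),
      C₂.IsCuspidal x ↔ ∀ y : C₂.Φ.carrier A, IsPrimary y → Precsim y x → C₂.IsCuspidal y) :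
    Literature.AnabelianGeometry.EtaleTheta.Cor38_iii h :=
  h.cor38_iii_of_preservesPreSteps_weak hF₁ hF₂ h.standardIsotropicNotGroupLike_treeMonoidVocabWeak
    (h.preservesPreSteps_of_isFrobenioid_weak hF₁ hF₂) hD1₁ hDa₁ hDn₁ hDc₁ hD1₂ hDa₂ hDn₂ hDc₂

end TreeMonoidVocabWeak

/-! ### At the canonical category vocabulary `treeCatVocab`: `IsFrobenioid` from `hBmon` -/

section TreeCatVocabWeak

variable {D₀ : Type u₀} [Category.{v₀} D₀] {D₀' : Type u₀} [Category.{v₀} D₀']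
  {T : RealifiedDivisorMonoids (D₀ := D₀) treeMonoidVocabWeak.{w}}
  {T' : RealifiedDivisorMonoids (D₀ := D₀') treeMonoidVocabWeak.{w}}
  {D : Type u} [Category.{v} D] {D' : Type u} [Category.{v} D']
  {IsRational IsStrictlyRational : (Dᵒᵖ ⥤ CommMonCat.{w}) → Prop}
  {IsRational' IsStrictlyRational' : (D'ᵒᵖ ⥤ CommMonCat.{w}) → Prop}

/-- **[EtTh] Cor. 3.8 (iii), first clause, AS TYPED at the canonical category vocabulary over the WEAK monoid vocabulary,
modulo `hBmon_i : IsMonoidOn B_i` ("`𝔹` a monoid on `D`"; then `C_i → F_{Φ_i}` IS a Frobenioid, [FrdI] Thm. 5.2 (ii),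
`isFrobenioid_treeCatVocab_of_isMonoidOn`) and abc-iut-L2-d2's Def. 3.1 support axioms ONLY** — every row of the printed
proof is a theorem here.  PROVED. [cite: MochizukiEtTh2009, Cor 3.8 p.81] -/
theorem cor38_iii_treeCatVocab_of_isMonoidOn_weak
    {C₁ : TemperedFrobenioid T D (treeCatVocab D IsRational IsStrictlyRational)}
    {C₂ : TemperedFrobenioid T' D' (treeCatVocab D' IsRational' IsStrictlyRational')} (h : Cor38Hyp C₁ C₂)
    (hBmon₁ : IsMonoidOn C₁.ratFnFunctor) (hBmon₂ : IsMonoidOn C₂.ratFnFunctor)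
    (hD1₁ : ∀ (A : Dᵒᵖ) (y : C₁.Φ.carrier A), C₁.IsBaseFieldTheoreticDiv y → C₁.IsNonCuspidal y)
    (hDa₁ : ∀ (A : Dᵒᵖ) (x : C₁.Φ.carrier A), C₁.IsNonCuspidal x → C₁.IsCuspidal x → x = 1)
    (hDn₁ : ∀ (A : Dᵒᵖ) (x : C₁.Φ.carrier A),
      C₁.IsNonCuspidal x ↔ ∀ y : C₁.Φ.carrier A, IsPrimary y → Precsim y x → C₁.IsNonCuspidal y)
    (hDc₁ : ∀ (A : Dᵒᵖ) (x : C₁.Φ.carrier A),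
      C₁.IsCuspidal x ↔ ∀ y : C₁.Φ.carrier A, IsPrimary y → Precsim y x → C₁.IsCuspidal y)
    (hD1₂ : ∀ (A : D'ᵒᵖ) (y : C₂.Φ.carrier A), C₂.IsBaseFieldTheoreticDiv y → C₂.IsNonCuspidal y)
    (hDa₂ : ∀ (A : D'ᵒᵖ) (x : C₂.Φ.carrier A), C₂.IsNonCuspidal x → C₂.IsCuspidal x → x = 1)
    (hDn₂ : ∀ (A : D'ᵒᵖ) (x : C₂.Φ.carrier A),
      C₂.IsNonCuspidal x ↔ ∀ y : C₂.Φ.carrier A, IsPrimary y → Precsim y x → C₂.IsNonCuspidal y)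
    (hDc₂ : ∀ (A : D'ᵒᵖ) (x : C₂.Φ.carrier A),
      C₂.IsCuspidal x ↔ ∀ y : C₂.Φ.carrier A, IsPrimary y → Precsim y x → C₂.IsCuspidal y) :
    Literature.AnabelianGeometry.EtaleTheta.Cor38_iii h :=
  h.cor38_iii_of_isFrobenioid_weak (C₁.isFrobenioid_treeCatVocab_of_isMonoidOn hBmon₁)
    (C₂.isFrobenioid_treeCatVocab_of_isMonoidOn hBmon₂) hD1₁ hDa₁ hDn₁ hDc₁ hD1₂ hDa₂ hDn₂ hDc₂

end TreeCatVocabWeak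

end Cor38Hyp

end Literature.AnabelianGeometry.EtaleTheta
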